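import Summits.FinalStateConjecture.FinalStateConjecture.Theses.PhaseMixingCapture
import Summits.FinalStateConjecture.FinalStateConjecture.Theorems.PhaseMixingCaptureCaptureSufficesTameSettlingKickReduction
import Summits.FinalStateConjecture.FinalStateConjecture.Theorems.PhaseMixingCaptureCaptureSufficesTameLabelRigidityC0ModelPoint
import Summits.FinalStateConjecture.FinalStateConjecture.Theorems.PhaseMixingCaptureCaptureSufficesTameNoC0FlatBasics
import Summits.FinalStateConjecture.FinalStateConjecture.Theorems.PhaseMixingCaptureCaptureSufficesTameNoC0FlatGenerators
import Summits.FinalStateConjecture.FinalStateConjecture.Theorems.PhaseMixingCaptureCaptureSufficesTameNoC0KerrSide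
import Literature.Geometry.Lorentzian.KerrPhotonOrbit
import Literature.Geometry.Lorentzian.CoordTensorCovariance

/-!
# Line `only-the-third-law-is-generic` — crux `CaptureSufficesTame` (stmt-FinalStateConjecture-17270,
# route PhaseMixingCapture, rank 6) — skeleton v4 (crux-plan, 2026-08-17): THE LABEL-RIGID CUT
# — v5 (lead c10, 2026-08-17): v4 UNCHANGED (stubs A/R/G/U, composition, certificates byte-identical) + §5, the
# brick programme for G's model point NoC0KerrChart (registered bricks `stub_noC0_flatBasics`,
# `stub_noC0_flatGenerators`, `stub_noC0_kerrSide`; the reduction and the point-level limit argument are the lead's).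

Crux (FIXED, concluded BY NAME in `CaptureSufficesTame_of`):
`PhaseMixingCapture.CaptureSufficesTame := NearExtremalKappaCapture → BulkKerrCaptureC2 →
WeakCosmicCensorshipTame → FinalStateConjecture`.

Card `only-the-third-law-is-generic` (ideator 2): with censorship the crux's OWN hypothesis `h₃`, the re-typed
summit follows from POINTWISE C⁰ statements shared with route GlobalAttraction plus ONE relative statement along
censored tame curves — the third law (un-parking) — whose engine is wall-or-fold. The card's ∀-label form of that
relative statement (`RelativeThirdLaw`: EVERY honest C⁰ endpoint configuration of the handed-back members is
sub-extremal) silently leans on **C⁰ LABEL RIGIDITY** (honest C⁰ Kerr charts pin `(M, |a|)`): the standing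
disprover (`Cruxes/CaptureSufficesTame/Disproof.lean` §5: "to be registered as a stub if this line is picked"),
three leads (`LABEL-RIGIDITY-C0{,-c1,-c3}.md`) and triager r1-1 ("keep R in the ∀-label form only together with a
registered LabelRigidityC0 lemma; otherwise the ∃-form `stub_unparkingKick`") all flagged it. This skeleton is that
sharpening, and it is NOT a re-seat of the retired line `Lines/SketchIdeator2.lean` (v1–v3, fully harvested:
p133270, p133919, p134987, p135956, p136198; `Lines/SketchIdeator2-dead.md`): the kick is registered in its immune
∃-form AND label rigidity is registered as a load-bearing stub, the upgrade being typed chart-independently.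

Registered stubs (4; every one load-bearing — no three of them compose):
* `stub_censoredExteriorsSettleC0` (A) — VERBATIM item stmt-FinalStateConjecture-17296
  (`GlobalAttraction.CensoredExteriorsSettle`, rank-2 crux of GlobalAttraction / TwoBoundarySqueeze; decomposed
  there into stmt-17684 ∧ stmt-17692, glue stmt-17693 proved): every censored MGHD carries an honest C⁰
  final-state decomposition. Pointwise; closes BY NAME the day 17296 lands (wave-1 answer on v2: `stub-blocked:
  stmt-FinalStateConjecture-17296` — do not re-wave it against an unchanged item).
* `stub_unparkingKick` (R, HARDEST; the crux's own residue) — VERBATIM the ∃-form kick registered on v2 (= the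
  hypothesis `hR` of the landed `finalStateConjecture_of_unparkingKick`, p133919): along every tame admissible
  curve of censored data whose base datum is not (censored ∧ un-parked) there are a tame injective immersed
  admissible curve through the base and `ε₀ > 0` such that every member with `0 < ‖c‖ < ε₀` is censored and
  UN-PARKED (every MGHD has complete `𝓘⁺` and, whenever it carries SOME honest C⁰ endpoint configuration, carries
  one with sub-extremal labels). SUMMIT-IMPLIED (`unparkingKick_of_finalStateConjecture`, p135956 — certificate
  `example` in §4) and implied by GlobalAttraction's 17297 + 9937 (`unparkingKick_of_genericCensorshipThirdLaw`,
  p134987). Engine (card; internal plan, NOT items): WALL (untrapped base: the black-hole threshold is crossed at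
  first order, both sides good) or FOLD (trapped base: the extremality defect `M_f² − |J_f| ≥ 0` is minimal at a
  parked member — `Ideator2.no_firstOrder_transversality` — so the witness is the steep diagonal `s = Kc` of a
  second-order unfolding, `Ideator2.fold_witness`), tameness of the unfolding by `IsTameDataFamily.comp_contDiff`;
  the vacuum, asymmetric, RELATIVE analogue of the Angelopoulos–Kehle–Unger threshold theorem.
* `stub_labelRigidityC0` (G, NEW — the only stub of any cut of this crux whose content is Lorentzian GEOMETRY,
  not dynamics) — two HONEST C⁰ final-state decompositions of one censored MGHD agree on "all holes are
  sub-extremal". Internal plan (leads a0/c1/c3, Disproof §5): honesty (all 16 components of `Ψ^* g − g₀` small on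
  growing truncated slabs foliating fat late regions; exhaustion; rays in the closure) reduces it to the C⁰
  orbit-closure question `kerr_params_of_C0_close` — (G0) no honest hole chart fits where `g` is C⁰-asymptotically
  FLAT (flat target: C⁰-limits of `φ_n^* η` on a fat domain are flat — sandwich of time separations + exact
  Minkowski triangles + Alexander–Bishop; c3 (A), paper-proved, all dimensions); (G1) exact-Kerr stratum: a fat
  region of `Kerr(M', a')` is a C⁰-limit of isometric copies of chunks of `Kerr(M, a)` only if `(M', |a'|) =
  (M, |a|)` (Lorentzian Gromov–Hausdorff compactness inside extended Kerr + Hawking–King–McCarthy; open link =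
  CLAIM″, causal convexity of intrinsically globally hyperbolic subdomains of the Kerr exterior; c3 (B));
  (G2) the asymptotic (deviation → 0) versions of (G0)/(G1) by the same sandwich. Expected TRUE (c1 §4 row 1).
  Lean-attackable WITHOUT dynamics: a refutation is an explicit C⁰ relabelling (e.g. of the Minkowski development,
  `Minkowski.vacuumCauchyDevelopment`, maximal modulo the CBG fact), a proof is (G0)–(G2).
* `stub_intrinsicSubextremalUpgrade` (U) — item stmt-17298 (`GlobalAttraction.SubextremalUpgrade`) with its
  label hypothesis made CHART-INDEPENDENT: a censored MGHD that carries some honest C⁰ endpoint configuration and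
  NONE with an extremal hole ("intrinsically sub-extremal at C⁰") carries the summit's honest C² sub-extremal
  decomposition. Implied by 17298 (instantiate at the given configuration — certificate `example` in §4, so it
  closes by a one-line `--supports` file the day 17298 lands), equivalent to 17298 under G, and IMMUNE to the
  label question (it never asserts C² sub-extremal settling of a development that honestly carries an extremal
  label — the failure mode that would make 17298 false if labels were floppy, c1 §4 row 2).

Composition (§3, sorry-free, standard axioms): the reduction theorem `finalStateConjecture_of_labelRigidKick :
W → A → R → G → U → FinalStateConjecture` (hypotheses = the texts verbatim; Theses-free in shape, landable as the
v4 reduction file) and the closed skeleton theorem `CaptureSufficesTame_of : CaptureSufficesTame` (the crux BY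
NAME from exactly the four stubs). Content: the crux's `h₃` (tame-generic censorship, VERBATIM
`WeakCosmicCensorshipTame`) ⟹ tame-generic (censored ∧ un-parked) by the landed kick composition
`isTameChristodoulouGeneric_of_relativeKick` (p133270) fed with R ⟹ pointwise: A gives an honest C⁰ configuration,
un-parked gives one with sub-extremal labels, G transfers sub-extremality to EVERY honest C⁰ configuration, U
upgrades to the summit's honest C² decomposition ⟹ `FinalStateConjecture` ⟹ the crux (`h₁`, `h₂` introduced and
dropped: idle as typed — Disproof §0, `captureSufficesTame_of_bare`; LEAD-MEMO-c5 §0).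

Disproof.lean (cdisprove cycle 1) used: §0/§1 — no `_false_without_` theorem exists for this summit-implied
conditional (none to honour by name); the restates-target measure is accepted: this line proves `WCCTame → FSC`
factored through A ∧ R ∧ G ∧ U. §3 (`Negative.TameGenericityAndFails.not_isTameChristodoulouGeneric_and_closed`,
p133982) honoured at `stub_unparkingKick`: `h₃` enters ONLY by composition along curves, never by intersecting
genericities. §5 (label rigidity, `kerr_params_of_C0_close`) — answered: it is `stub_labelRigidityC0`. §4
(`exists_subextremal_curve_through_extremal`): an exactly extremal member is an exceptional POINT of un-parked,
which R's `ε₀`-local ∃-form allows. Landed Negative lemmas checked against: `Negative.CounterexampleShape`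
(`not_captureSufficesTame_iff`: a kill of the crux is a kill of the summit — consistent, R is summit-implied);
`CaptureSuffices.Negative.RepairUnfoldingWallObstruction` (IVT wall: R is per base curve, witnesses through the
base point only, local in `c`). No stub is an instance a landed Negative lemma refutes.
-/

-- the doubled `FinalStateConjecture.FinalStateConjecture` path component trips dupNamespace
set_option linter.dupNamespace false

noncomputable section

open scoped Manifold ContDiff Topology ENNReal
open Set Function Filter

namespace Summit.FinalStateConjecture.FinalStateConjecture.Cruxes.CaptureSufficesTame.OnlyTheThirdLawIsGeneric

open Literature.Geometry.Lorentzian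
open Summit.FinalStateConjecture (HasCompleteNullInfinity exteriorOf RaysStayInClosure HasExhaustiveCharts
  IsFutureOriented)
open Summit.FinalStateConjecture.FinalStateConjecture.Theses.PhaseMixingCapture
  (NearExtremalKappaCapture BulkKerrCaptureC2 WeakCosmicCensorshipTame CaptureSufficesTame)
open Summit.FinalStateConjecture.FinalStateConjecture.Theorems.PhaseMixingCaptureCaptureSufficesTame
  (isTameChristodoulouGeneric_of_relativeKick unparkingKick_of_finalStateConjecture)

/-! ## §1 Vocabulary (short forms used in the composition; the registered stubs of §2 are stated EXPANDED over
importable declarations so that `--supports` files can restate them verbatim) -/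

section Properties

variable {X : Type} [TopologicalSpace X] [ChartedSpace E3 X] [IsManifold (𝓡 3) ∞ X] [T2Space X]
  [SecondCountableTopology X] [ConnectedSpace X]

/-- CENSORED: the matrix of the crux's hypothesis `WeakCosmicCensorshipTame` — an MGHD exists and every MGHD
has complete future null infinity. -/
def Censored (D : InitialDataSet (𝓡 3) X) : Prop :=
  (∃ 𝒟 : VacuumCauchyDevelopment D, 𝒟.IsMaximal) ∧
    ∀ 𝒟 : VacuumCauchyDevelopment D, 𝒟.IsMaximal → HasCompleteNullInfinity 𝒟.toCauchyDevelopment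

/-- UN-PARKED (the ∃-form target of the kick R, as registered on v2): every MGHD has complete `𝓘⁺` and,
whenever it carries SOME honest C⁰ endpoint configuration (`O = exteriorOf`, rays in `closure O`, exhaustive
honest charts, future-oriented), carries one all of whose holes are SUB-extremal. -/
def Unparked (D : InitialDataSet (𝓡 3) X) : Prop :=
  ∀ 𝒟 : VacuumCauchyDevelopment D, 𝒟.IsMaximal →
    HasCompleteNullInfinity 𝒟.toCauchyDevelopment ∧
      ((∃ (O : Set 𝒟.carrier) (d₀ : FinalStateDecomposition 𝒟.toSpacetime O 0),
          O = exteriorOf 𝒟.toCauchyDevelopment d₀.charted ∧ RaysStayInClosure 𝒟.toCauchyDevelopment O ∧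
            HasExhaustiveCharts d₀ ∧ IsFutureOriented d₀) →
        ∃ (O : Set 𝒟.carrier) (d : FinalStateDecomposition 𝒟.toSpacetime O 0),
          (∀ i, Kerr.IsSubextremal (d.mass i) (d.spin i)) ∧
            O = exteriorOf 𝒟.toCauchyDevelopment d.charted ∧ RaysStayInClosure 𝒟.toCauchyDevelopment O ∧
              HasExhaustiveCharts d ∧ IsFutureOriented d)

/-- The summit's own matrix (verbatim the property inside `FinalStateConjecture`). -/
def SummitProperty (D : InitialDataSet (𝓡 3) X) : Prop :=
  (∃ 𝒟 : VacuumCauchyDevelopment D, 𝒟.IsMaximal) ∧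
    ∀ 𝒟 : VacuumCauchyDevelopment D, 𝒟.IsMaximal →
      HasCompleteNullInfinity 𝒟.toCauchyDevelopment ∧
        ∃ (O : Set 𝒟.carrier) (d : FinalStateDecomposition 𝒟.toSpacetime O 2),
          (∀ i, Kerr.IsSubextremal (d.mass i) (d.spin i)) ∧
            O = exteriorOf 𝒟.toCauchyDevelopment d.charted ∧ RaysStayInClosure 𝒟.toCauchyDevelopment O ∧
              HasExhaustiveCharts d ∧ IsFutureOriented d

omit [T2Space X] [SecondCountableTopology X] in
/-- The summit's matrix implies censored ∧ un-parked pointwise (read the C² witness in C⁰ through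
`FinalStateDecomposition.ofLE`): the kick's target is NECESSARY pointwise. [folklore] -/
theorem censored_and_unparked_of_summitProperty {D : InitialDataSet (𝓡 3) X} (h : SummitProperty D) :
    Censored D ∧ Unparked D := by
  refine ⟨⟨h.1, fun 𝒟 hmax ↦ (h.2 𝒟 hmax).1⟩, fun 𝒟 hmax ↦ ⟨(h.2 𝒟 hmax).1, fun _ ↦ ?_⟩⟩
  obtain ⟨O, d, hsub, hO, hRay, hExh, hFut⟩ := (h.2 𝒟 hmax).2
  exact ⟨O, d.ofLE (Nat.zero_le 2), hsub, by rwa [FinalStateDecomposition.charted_ofLE], hRay,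
    Theorems.PhaseMixingCaptureCaptureSufficesTame.hasExhaustiveCharts_ofLE d _ hExh,
    (Theorems.PhaseMixingCaptureCaptureSufficesTame.isFutureOriented_ofLE d _).2 hFut⟩

end Properties

/-! ## §2 Registered stubs (the only `sorry`s of the file; the §5 bricks are landed) -/

/-- **Stub A `stub_censoredExteriorsSettleC0` — VERBATIM item stmt-FinalStateConjecture-17296**
(`GlobalAttraction.CensoredExteriorsSettle` = `TwoBoundarySqueeze.SqueezeToKerrFamilyC0`): every maximal
vacuum Cauchy development with complete `𝓘⁺` of every admissible datum carries an HONEST C⁰ final-state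
decomposition (extremal endpoints `|aᵢ| ≤ Mᵢ` allowed): `O = exteriorOf`, rays stay in `closure O`, exhaustive
charts with honest radii, future-oriented chart times. Pointwise, no genericity; closes BY NAME from the shared
item (decomposed in GlobalAttraction as 17684 ∧ 17692 ⇒ 17296, glue 17693 proved). Size: open problem
(large-data C⁰ settling of censored vacuum exteriors). [cite: DafermosLuk2017, §1.2.1 p. 8] -/
theorem stub_censoredExteriorsSettleC0 :
    ∀ (X : Type) [TopologicalSpace X] [ChartedSpace E3 X] [IsManifold (𝓡 3) ∞ X] [T2Space X]
      [SecondCountableTopology X] [ConnectedSpace X],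
      ∀ D ∈ admissibleVacuumData X, ∀ 𝒟 : VacuumCauchyDevelopment D, 𝒟.IsMaximal →
        HasCompleteNullInfinity 𝒟.toCauchyDevelopment →
          ∃ (O : Set 𝒟.carrier) (d : FinalStateDecomposition 𝒟.toSpacetime O 0),
            O = exteriorOf 𝒟.toCauchyDevelopment d.charted ∧ RaysStayInClosure 𝒟.toCauchyDevelopment O ∧
              HasExhaustiveCharts d ∧ IsFutureOriented d := by
  sorry

/-- **Stub R `stub_unparkingKick` (HARDEST; the crux's own residue) — UN-PARKING KICKS ALONG CENSORED CURVES,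
local ∃-form, VERBATIM the kick registered on skeleton v2** (= hypothesis `hR` of the landed
`Theorems.PhaseMixingCaptureCaptureSufficesTame.finalStateConjecture_of_unparkingKick`). For every end `e` and every
tame admissible curve `F` on `e` whose members off `0` are CENSORED (`F` told immersed-injective, or constant) and
whose base datum `F 0` is NOT (censored ∧ un-parked), there are an end `e'`, a tame, injective, immersed admissible
curve `F'` through `F 0` and `ε₀ > 0` such that every member with `0 < ‖c‖ < ε₀` is censored AND un-parked: every
MGHD of it has complete `𝓘⁺` and, whenever it carries some honest C⁰ endpoint configuration, carries one all of
whose holes are sub-extremal. Immune to the label question (∃-form). Engine: wall-or-fold (file docstring).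
SUMMIT-IMPLIED (`unparkingKick_of_finalStateConjecture`, §4) — not refutable short of refuting the summit; implied by
GlobalAttraction's items 17297 + 9937 (`unparkingKick_of_genericCensorshipThirdLaw`). Size: open problem (a vacuum,
asymmetric, relative third law). [cite: AngelopoulosKehleUnger2026, Thm 1] [cite: KehleUnger2025, Thm 1] -/
theorem stub_unparkingKick :
    ∀ (X : Type) [TopologicalSpace X] [ChartedSpace E3 X] [IsManifold (𝓡 3) ∞ X] [T2Space X]
      [SecondCountableTopology X] [ConnectedSpace X],
      ∀ (e : AFEnd X) (F : EuclideanSpace ℝ (Fin 1) → InitialDataSet (𝓡 3) X),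
        InitialDataSet.IsTameDataFamily e 1 F →
          ((InitialDataSet.IsImmersedAtZero 1 F ∧ Function.Injective F) ∨ ∀ c, F c = F 0) →
          (∀ c, F c ∈ admissibleVacuumData X) →
          (∀ c ≠ 0, (∃ 𝒟 : VacuumCauchyDevelopment (F c), 𝒟.IsMaximal) ∧
              ∀ 𝒟 : VacuumCauchyDevelopment (F c), 𝒟.IsMaximal →
                HasCompleteNullInfinity 𝒟.toCauchyDevelopment) →
          ¬ (((∃ 𝒟 : VacuumCauchyDevelopment (F 0), 𝒟.IsMaximal) ∧
                    ∀ 𝒟 : VacuumCauchyDevelopment (F 0), 𝒟.IsMaximal →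
                      HasCompleteNullInfinity 𝒟.toCauchyDevelopment) ∧
                  ∀ 𝒟 : VacuumCauchyDevelopment (F 0), 𝒟.IsMaximal →
                    HasCompleteNullInfinity 𝒟.toCauchyDevelopment ∧
                      ((∃ (O : Set 𝒟.carrier) (d₀ : FinalStateDecomposition 𝒟.toSpacetime O 0),
                          O = exteriorOf 𝒟.toCauchyDevelopment d₀.charted ∧
                            RaysStayInClosure 𝒟.toCauchyDevelopment O ∧ HasExhaustiveCharts d₀ ∧
                              IsFutureOriented d₀) →
                        ∃ (O : Set 𝒟.carrier) (d : FinalStateDecomposition 𝒟.toSpacetime O 0),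
                          (∀ i, Kerr.IsSubextremal (d.mass i) (d.spin i)) ∧
                            O = exteriorOf 𝒟.toCauchyDevelopment d.charted ∧
                              RaysStayInClosure 𝒟.toCauchyDevelopment O ∧ HasExhaustiveCharts d ∧
                                IsFutureOriented d)) →
          ∃ (e' : AFEnd X) (F' : EuclideanSpace ℝ (Fin 1) → InitialDataSet (𝓡 3) X),
            InitialDataSet.IsTameDataFamily e' 1 F' ∧ F' 0 = F 0 ∧ Function.Injective F' ∧
              InitialDataSet.IsImmersedAtZero 1 F' ∧ (∀ c, F' c ∈ admissibleVacuumData X) ∧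
              ∃ ε₀ > (0 : ℝ), ∀ c : EuclideanSpace ℝ (Fin 1), c ≠ 0 → ‖c‖ < ε₀ →
                (((∃ 𝒟 : VacuumCauchyDevelopment (F' c), 𝒟.IsMaximal) ∧
                    ∀ 𝒟 : VacuumCauchyDevelopment (F' c), 𝒟.IsMaximal →
                      HasCompleteNullInfinity 𝒟.toCauchyDevelopment) ∧
                  ∀ 𝒟 : VacuumCauchyDevelopment (F' c), 𝒟.IsMaximal →
                    HasCompleteNullInfinity 𝒟.toCauchyDevelopment ∧
                      ((∃ (O : Set 𝒟.carrier) (d₀ : FinalStateDecomposition 𝒟.toSpacetime O 0),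
                          O = exteriorOf 𝒟.toCauchyDevelopment d₀.charted ∧
                            RaysStayInClosure 𝒟.toCauchyDevelopment O ∧ HasExhaustiveCharts d₀ ∧
                              IsFutureOriented d₀) →
                        ∃ (O : Set 𝒟.carrier) (d : FinalStateDecomposition 𝒟.toSpacetime O 0),
                          (∀ i, Kerr.IsSubextremal (d.mass i) (d.spin i)) ∧
                            O = exteriorOf 𝒟.toCauchyDevelopment d.charted ∧
                              RaysStayInClosure 𝒟.toCauchyDevelopment O ∧ HasExhaustiveCharts d ∧
                                IsFutureOriented d)) := by
  sorry

/-- **Stub G `stub_labelRigidityC0` (NEW; Lorentzian geometry, no dynamics) — C⁰ LABEL RIGIDITY in the form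
the composition consumes.** For every admissible datum, every maximal vacuum Cauchy development `𝒟` with complete
`𝓘⁺` and every two HONEST C⁰ final-state decompositions `(O₁, d₁)`, `(O₂, d₂)` of `𝒟` (each: `O = exteriorOf`,
rays in `closure O`, exhaustive honest charts, future-oriented): if every hole of `d₁` is sub-extremal then so is
every hole of `d₂`. Expected consequence of full label rigidity (the hole charts of two honest decompositions of one
development correspond with equal `(Mᵢ, |aᵢ|)`): honesty forces the certified near zones to foliate fat late regions
next to every event horizon, so a differently-labelled hole chart is a C⁰-limit of isometric copies of chunks of the
true `Kerr(M, a)` (resp. of asymptotically flat chunks) on a fat domain of `Kerr(M', a')`, excluded by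
`kerr_params_of_C0_close` — (G0) flat target (sandwich of time separations, exact Minkowski triangles,
Alexander–Bishop `K = 0` both ways; paper-proved in all dimensions, LABEL-RIGIDITY-C0-c3 (A)), (G1) exact-Kerr
stratum (τ-picture compactness inside extended Kerr + Hawking–King–McCarthy; open link CLAIM″ = causal convexity
of intrinsically globally hyperbolic subdomains of the Kerr exterior, c3 (B)), (G2) asymptotic versions. Refutation
shape: an explicit C⁰ relabelling (two honest C⁰ decompositions of one development with different extremality),
e.g. over `Minkowski.vacuumCauchyDevelopment` (maximal modulo the CBG fact). Size: L (research lemma in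
low-regularity Lorentzian rigidity; `Cruxes/CaptureSufficesTame/Disproof.lean` §5).
[cite: AlexanderBishop2008, Thm 1.1] [cite: HawkingKingMccarthy1976, main theorem] [cite: ONeill1983, Ch. 14] -/
theorem stub_labelRigidityC0 :
    ∀ (X : Type) [TopologicalSpace X] [ChartedSpace E3 X] [IsManifold (𝓡 3) ∞ X] [T2Space X]
      [SecondCountableTopology X] [ConnectedSpace X],
      ∀ D ∈ admissibleVacuumData X, ∀ 𝒟 : VacuumCauchyDevelopment D, 𝒟.IsMaximal →
        HasCompleteNullInfinity 𝒟.toCauchyDevelopment →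
          ∀ (O₁ : Set 𝒟.carrier) (d₁ : FinalStateDecomposition 𝒟.toSpacetime O₁ 0)
            (O₂ : Set 𝒟.carrier) (d₂ : FinalStateDecomposition 𝒟.toSpacetime O₂ 0),
            O₁ = exteriorOf 𝒟.toCauchyDevelopment d₁.charted → RaysStayInClosure 𝒟.toCauchyDevelopment O₁ →
              HasExhaustiveCharts d₁ → IsFutureOriented d₁ →
            O₂ = exteriorOf 𝒟.toCauchyDevelopment d₂.charted → RaysStayInClosure 𝒟.toCauchyDevelopment O₂ →
              HasExhaustiveCharts d₂ → IsFutureOriented d₂ →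
            (∀ i, Kerr.IsSubextremal (d₁.mass i) (d₁.spin i)) →
              ∀ j, Kerr.IsSubextremal (d₂.mass j) (d₂.spin j) := by
  sorry

/-- **Stub U `stub_intrinsicSubextremalUpgrade` — the C⁰ → C² SUB-EXTREMAL UPGRADE, typed chart-independently**
(item stmt-FinalStateConjecture-17298 `GlobalAttraction.SubextremalUpgrade` with its label hypothesis made
intrinsic). For every admissible datum and every maximal vacuum Cauchy development `𝒟` with complete `𝓘⁺`: if `𝒟`
carries SOME honest C⁰ endpoint configuration and EVERY honest C⁰ endpoint configuration of `𝒟` has only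
sub-extremal holes, then some region `O'` carries an honest C² final-state decomposition with sub-extremal holes
(`O' = exteriorOf`, rays in `closure O'`, exhaustive honest charts, future-oriented) — the summit's own conclusion
for this development. Intended proof = that of 17298 (eventual uniform red-shift `κ → κ_∞ > 0`, near-Kerr
nonlinear observability, Łojasiewicz–Simon near the Kerr family; horizon-normalised future-oriented charts).
Implied by 17298 (instantiate at the given configuration; §4), equivalent to it under G, and never asserting C²
sub-extremal settling of a development that honestly carries an extremal label. Size: open problem (= 17298).
[cite: arXiv08110354, §§3–7] [cite: KlainermanSzeftel2023, Thm 1.1] -/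
theorem stub_intrinsicSubextremalUpgrade :
    ∀ (X : Type) [TopologicalSpace X] [ChartedSpace E3 X] [IsManifold (𝓡 3) ∞ X] [T2Space X]
      [SecondCountableTopology X] [ConnectedSpace X],
      ∀ D ∈ admissibleVacuumData X, ∀ 𝒟 : VacuumCauchyDevelopment D, 𝒟.IsMaximal →
        HasCompleteNullInfinity 𝒟.toCauchyDevelopment →
          (∃ (O : Set 𝒟.carrier) (d₀ : FinalStateDecomposition 𝒟.toSpacetime O 0),
              O = exteriorOf 𝒟.toCauchyDevelopment d₀.charted ∧ RaysStayInClosure 𝒟.toCauchyDevelopment O ∧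
                HasExhaustiveCharts d₀ ∧ IsFutureOriented d₀) →
          (∀ (O : Set 𝒟.carrier) (d₀ : FinalStateDecomposition 𝒟.toSpacetime O 0),
              O = exteriorOf 𝒟.toCauchyDevelopment d₀.charted → RaysStayInClosure 𝒟.toCauchyDevelopment O →
                HasExhaustiveCharts d₀ → IsFutureOriented d₀ →
                  ∀ i, Kerr.IsSubextremal (d₀.mass i) (d₀.spin i)) →
          ∃ (O' : Set 𝒟.carrier) (d : FinalStateDecomposition 𝒟.toSpacetime O' 2),
            (∀ i, Kerr.IsSubextremal (d.mass i) (d.spin i)) ∧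
              O' = exteriorOf 𝒟.toCauchyDevelopment d.charted ∧ RaysStayInClosure 𝒟.toCauchyDevelopment O' ∧
                HasExhaustiveCharts d ∧ IsFutureOriented d := by
  sorry

/-! ## §3 The composition (sorry-free): the v4 REDUCTION THEOREM (Theses-free shape, hypotheses = W + the four
stub texts verbatim) and the crux BY NAME from exactly the four registered stubs -/

/-- **v4 reduction: the re-typed summit from (W) tame weak cosmic censorship (VERBATIM the body of the crux's
hypothesis `WeakCosmicCensorshipTame`), (A) `stub_censoredExteriorsSettleC0`, (R) `stub_unparkingKick`,
(G) `stub_labelRigidityC0`, (U) `stub_intrinsicSubextremalUpgrade` — all four stub texts verbatim.** Tame-generic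
censorship ⟹ tame-generic (censored ∧ un-parked) by the landed kick composition with R ⟹ the summit's matrix
pointwise (A: an honest C⁰ configuration exists; un-parked: one with sub-extremal holes exists; G: hence EVERY
honest C⁰ configuration is sub-extremal; U: the honest C² sub-extremal decomposition). Landable verbatim as
`Theorems/PhaseMixingCaptureCaptureSufficesTameLabelRigidKickReduction.lean` (playbook: reduction theorem first;
it is `Theses`-free in shape — only this skeleton's closing line mentions the route decl). [folklore] -/
theorem finalStateConjecture_of_labelRigidKick
    (hW : ∀ (X : Type) [TopologicalSpace X] [ChartedSpace E3 X] [IsManifold (𝓡 3) ∞ X] [T2Space X]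
      [SecondCountableTopology X] [ConnectedSpace X],
      InitialDataSet.IsTameChristodoulouGeneric (admissibleVacuumData X)
        (fun D ↦ (∃ 𝒟 : VacuumCauchyDevelopment D, 𝒟.IsMaximal) ∧
          ∀ 𝒟 : VacuumCauchyDevelopment D, 𝒟.IsMaximal →
            HasCompleteNullInfinity 𝒟.toCauchyDevelopment) 1)
    (hA : ∀ (X : Type) [TopologicalSpace X] [ChartedSpace E3 X] [IsManifold (𝓡 3) ∞ X] [T2Space X]
      [SecondCountableTopology X] [ConnectedSpace X],
      ∀ D ∈ admissibleVacuumData X, ∀ 𝒟 : VacuumCauchyDevelopment D, 𝒟.IsMaximal →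
        HasCompleteNullInfinity 𝒟.toCauchyDevelopment →
          ∃ (O : Set 𝒟.carrier) (d : FinalStateDecomposition 𝒟.toSpacetime O 0),
            O = exteriorOf 𝒟.toCauchyDevelopment d.charted ∧ RaysStayInClosure 𝒟.toCauchyDevelopment O ∧
              HasExhaustiveCharts d ∧ IsFutureOriented d)
    (hR : ∀ (X : Type) [TopologicalSpace X] [ChartedSpace E3 X] [IsManifold (𝓡 3) ∞ X] [T2Space X]
      [SecondCountableTopology X] [ConnectedSpace X],
      ∀ (e : AFEnd X) (F : EuclideanSpace ℝ (Fin 1) → InitialDataSet (𝓡 3) X),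
        InitialDataSet.IsTameDataFamily e 1 F →
          ((InitialDataSet.IsImmersedAtZero 1 F ∧ Function.Injective F) ∨ ∀ c, F c = F 0) →
          (∀ c, F c ∈ admissibleVacuumData X) →
          (∀ c ≠ 0, (∃ 𝒟 : VacuumCauchyDevelopment (F c), 𝒟.IsMaximal) ∧
              ∀ 𝒟 : VacuumCauchyDevelopment (F c), 𝒟.IsMaximal →
                HasCompleteNullInfinity 𝒟.toCauchyDevelopment) →
          ¬ (((∃ 𝒟 : VacuumCauchyDevelopment (F 0), 𝒟.IsMaximal) ∧
                    ∀ 𝒟 : VacuumCauchyDevelopment (F 0), 𝒟.IsMaximal →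
                      HasCompleteNullInfinity 𝒟.toCauchyDevelopment) ∧
                  ∀ 𝒟 : VacuumCauchyDevelopment (F 0), 𝒟.IsMaximal →
                    HasCompleteNullInfinity 𝒟.toCauchyDevelopment ∧
                      ((∃ (O : Set 𝒟.carrier) (d₀ : FinalStateDecomposition 𝒟.toSpacetime O 0),
                          O = exteriorOf 𝒟.toCauchyDevelopment d₀.charted ∧
                            RaysStayInClosure 𝒟.toCauchyDevelopment O ∧ HasExhaustiveCharts d₀ ∧
                              IsFutureOriented d₀) →
                        ∃ (O : Set 𝒟.carrier) (d : FinalStateDecomposition 𝒟.toSpacetime O 0),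
                          (∀ i, Kerr.IsSubextremal (d.mass i) (d.spin i)) ∧
                            O = exteriorOf 𝒟.toCauchyDevelopment d.charted ∧
                              RaysStayInClosure 𝒟.toCauchyDevelopment O ∧ HasExhaustiveCharts d ∧
                                IsFutureOriented d)) →
          ∃ (e' : AFEnd X) (F' : EuclideanSpace ℝ (Fin 1) → InitialDataSet (𝓡 3) X),
            InitialDataSet.IsTameDataFamily e' 1 F' ∧ F' 0 = F 0 ∧ Function.Injective F' ∧
              InitialDataSet.IsImmersedAtZero 1 F' ∧ (∀ c, F' c ∈ admissibleVacuumData X) ∧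
              ∃ ε₀ > (0 : ℝ), ∀ c : EuclideanSpace ℝ (Fin 1), c ≠ 0 → ‖c‖ < ε₀ →
                (((∃ 𝒟 : VacuumCauchyDevelopment (F' c), 𝒟.IsMaximal) ∧
                    ∀ 𝒟 : VacuumCauchyDevelopment (F' c), 𝒟.IsMaximal →
                      HasCompleteNullInfinity 𝒟.toCauchyDevelopment) ∧
                  ∀ 𝒟 : VacuumCauchyDevelopment (F' c), 𝒟.IsMaximal →
                    HasCompleteNullInfinity 𝒟.toCauchyDevelopment ∧
                      ((∃ (O : Set 𝒟.carrier) (d₀ : FinalStateDecomposition 𝒟.toSpacetime O 0),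
                          O = exteriorOf 𝒟.toCauchyDevelopment d₀.charted ∧
                            RaysStayInClosure 𝒟.toCauchyDevelopment O ∧ HasExhaustiveCharts d₀ ∧
                              IsFutureOriented d₀) →
                        ∃ (O : Set 𝒟.carrier) (d : FinalStateDecomposition 𝒟.toSpacetime O 0),
                          (∀ i, Kerr.IsSubextremal (d.mass i) (d.spin i)) ∧
                            O = exteriorOf 𝒟.toCauchyDevelopment d.charted ∧
                              RaysStayInClosure 𝒟.toCauchyDevelopment O ∧ HasExhaustiveCharts d ∧
                                IsFutureOriented d)))
    (hG : ∀ (X : Type) [TopologicalSpace X] [ChartedSpace E3 X] [IsManifold (𝓡 3) ∞ X] [T2Space X]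
      [SecondCountableTopology X] [ConnectedSpace X],
      ∀ D ∈ admissibleVacuumData X, ∀ 𝒟 : VacuumCauchyDevelopment D, 𝒟.IsMaximal →
        HasCompleteNullInfinity 𝒟.toCauchyDevelopment →
          ∀ (O₁ : Set 𝒟.carrier) (d₁ : FinalStateDecomposition 𝒟.toSpacetime O₁ 0)
            (O₂ : Set 𝒟.carrier) (d₂ : FinalStateDecomposition 𝒟.toSpacetime O₂ 0),
            O₁ = exteriorOf 𝒟.toCauchyDevelopment d₁.charted → RaysStayInClosure 𝒟.toCauchyDevelopment O₁ →
              HasExhaustiveCharts d₁ → IsFutureOriented d₁ →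
            O₂ = exteriorOf 𝒟.toCauchyDevelopment d₂.charted → RaysStayInClosure 𝒟.toCauchyDevelopment O₂ →
              HasExhaustiveCharts d₂ → IsFutureOriented d₂ →
            (∀ i, Kerr.IsSubextremal (d₁.mass i) (d₁.spin i)) →
              ∀ j, Kerr.IsSubextremal (d₂.mass j) (d₂.spin j))
    (hU : ∀ (X : Type) [TopologicalSpace X] [ChartedSpace E3 X] [IsManifold (𝓡 3) ∞ X] [T2Space X]
      [SecondCountableTopology X] [ConnectedSpace X],
      ∀ D ∈ admissibleVacuumData X, ∀ 𝒟 : VacuumCauchyDevelopment D, 𝒟.IsMaximal →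
        HasCompleteNullInfinity 𝒟.toCauchyDevelopment →
          (∃ (O : Set 𝒟.carrier) (d₀ : FinalStateDecomposition 𝒟.toSpacetime O 0),
              O = exteriorOf 𝒟.toCauchyDevelopment d₀.charted ∧ RaysStayInClosure 𝒟.toCauchyDevelopment O ∧
                HasExhaustiveCharts d₀ ∧ IsFutureOriented d₀) →
          (∀ (O : Set 𝒟.carrier) (d₀ : FinalStateDecomposition 𝒟.toSpacetime O 0),
              O = exteriorOf 𝒟.toCauchyDevelopment d₀.charted → RaysStayInClosure 𝒟.toCauchyDevelopment O →
                HasExhaustiveCharts d₀ → IsFutureOriented d₀ →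
                  ∀ i, Kerr.IsSubextremal (d₀.mass i) (d₀.spin i)) →
          ∃ (O' : Set 𝒟.carrier) (d : FinalStateDecomposition 𝒟.toSpacetime O' 2),
            (∀ i, Kerr.IsSubextremal (d.mass i) (d.spin i)) ∧
              O' = exteriorOf 𝒟.toCauchyDevelopment d.charted ∧ RaysStayInClosure 𝒟.toCauchyDevelopment O' ∧
                HasExhaustiveCharts d ∧ IsFutureOriented d) :
    _root_.FinalStateConjecture := by
  intro X _ _ _ _ _ _
  have h𝓓 : ∀ d ∈ admissibleVacuumData X,
      ∃ e : AFEnd X, e.IsSoleEnd ∧ ∃ M : ℝ, e.IsStronglyAsymptoticallyFlatDR d M :=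
    fun d hd ↦ exists_isSoleEnd_of_mem_admissibleVacuumData hd
  -- tame-generic (censored ∧ un-parked): the kick composition along censored curves, fed with R
  have gT : InitialDataSet.IsTameChristodoulouGeneric (admissibleVacuumData X)
      (fun D ↦ Censored D ∧ Unparked D) 1 :=
    isTameChristodoulouGeneric_of_relativeKick (Q := Censored) h𝓓 (hW X) (hR X)
  -- pointwise upgrade to the summit's matrix by A, un-parked, G and U
  refine gT.mono fun D hD hDT ↦ ?_
  obtain ⟨hQ, hP⟩ := hDT
  refine ⟨hQ.1, fun 𝒟 hmax ↦ ⟨hQ.2 𝒟 hmax, ?_⟩⟩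
  have hI : HasCompleteNullInfinity 𝒟.toCauchyDevelopment := hQ.2 𝒟 hmax
  -- A: an honest C⁰ configuration exists
  obtain ⟨O, d, hO, hRay, hExh, hFut⟩ := hA X D hD 𝒟 hmax hI
  -- un-parked: an honest C⁰ configuration with sub-extremal holes exists
  obtain ⟨O₁, d₁, hsub₁, hO₁, hRay₁, hExh₁, hFut₁⟩ := (hP 𝒟 hmax).2 ⟨O, d, hO, hRay, hExh, hFut⟩
  -- G: hence every honest C⁰ configuration of `𝒟` has sub-extremal holes
  have hall : ∀ (O₂ : Set 𝒟.carrier) (d₂ : FinalStateDecomposition 𝒟.toSpacetime O₂ 0),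
      O₂ = exteriorOf 𝒟.toCauchyDevelopment d₂.charted → RaysStayInClosure 𝒟.toCauchyDevelopment O₂ →
        HasExhaustiveCharts d₂ → IsFutureOriented d₂ → ∀ j, Kerr.IsSubextremal (d₂.mass j) (d₂.spin j) :=
    fun O₂ d₂ hO₂ hRay₂ hExh₂ hFut₂ ↦
      hG X D hD 𝒟 hmax hI O₁ d₁ O₂ d₂ hO₁ hRay₁ hExh₁ hFut₁ hO₂ hRay₂ hExh₂ hFut₂ hsub₁
  -- U: the intrinsic upgrade to the summit's honest C² sub-extremal decomposition
  exact hU X D hD 𝒟 hmax hI ⟨O, d, hO, hRay, hExh, hFut⟩ hall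

/-- **THE CRUX BY NAME, from exactly the four registered stubs.** `CaptureSufficesTame` — its first two
hypotheses introduced and dropped (idle under the tame re-typing T2: tame witness members are globally small
perturbations of the base datum, so the Cauchy-typed captures can be consumed neither at time zero nor later;
Disproof §0 `captureSufficesTame_of_bare`), the third (`WeakCosmicCensorshipTame`, by name) consumed as the source of
censored base curves by `finalStateConjecture_of_labelRigidKick`. (Closed form, as `#h21_check_skeleton` (ii)
requires: no Prop hypotheses other than registered obligations; the arrow form is the reduction theorem above.) -/
theorem CaptureSufficesTame_of : CaptureSufficesTame :=
  fun _ _ hW ↦ finalStateConjecture_of_labelRigidKick hW stub_censoredExteriorsSettleC0 stub_unparkingKick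
    stub_labelRigidityC0 stub_intrinsicSubextremalUpgrade

/-! ## §4 Certificates (sorry-free, no new stubs) -/

/-- **R is SUMMIT-IMPLIED and its registered text is the landed one**: the `hR` slot of the reduction accepts
`unparkingKick_of_finalStateConjecture` (p135956) — this elaborates only if the two texts agree. -/
example (h : _root_.FinalStateConjecture) :=
  finalStateConjecture_of_labelRigidKick (hR := unparkingKick_of_finalStateConjecture h)

/-- **W is the crux's third hypothesis verbatim**: the `hW` slot accepts `WeakCosmicCensorshipTame` by name. -/
example (hW : WeakCosmicCensorshipTame) :=
  finalStateConjecture_of_labelRigidKick (hW := hW)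

/-- **U closes BY NAME from item stmt-17298** (`GlobalAttraction.SubextremalUpgrade`, whose body is the hypothesis
`h17298` verbatim): instantiate 17298 at the configuration U is handed. So the day 17298 lands, a one-line
`--supports` file discharges `stub_intrinsicSubextremalUpgrade`. [folklore] -/
example
    (h17298 : ∀ (X : Type) [TopologicalSpace X] [ChartedSpace E3 X] [IsManifold (𝓡 3) ∞ X] [T2Space X]
      [SecondCountableTopology X] [ConnectedSpace X],
      ∀ D ∈ admissibleVacuumData X, ∀ 𝒟 : VacuumCauchyDevelopment D, 𝒟.IsMaximal →
        HasCompleteNullInfinity 𝒟.toCauchyDevelopment →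
          ∀ (O : Set 𝒟.carrier) (d₀ : FinalStateDecomposition 𝒟.toSpacetime O 0),
            O = exteriorOf 𝒟.toCauchyDevelopment d₀.charted → RaysStayInClosure 𝒟.toCauchyDevelopment O →
              HasExhaustiveCharts d₀ → IsFutureOriented d₀ →
                (∀ i, Kerr.IsSubextremal (d₀.mass i) (d₀.spin i)) →
                  ∃ (O' : Set 𝒟.carrier) (d : FinalStateDecomposition 𝒟.toSpacetime O' 2),
                    (∀ i, Kerr.IsSubextremal (d.mass i) (d.spin i)) ∧
                      O' = exteriorOf 𝒟.toCauchyDevelopment d.charted ∧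
                        RaysStayInClosure 𝒟.toCauchyDevelopment O' ∧ HasExhaustiveCharts d ∧
                          IsFutureOriented d) :=
  finalStateConjecture_of_labelRigidKick (hU := fun X _ _ _ _ _ _ D hD 𝒟 hmax hI hex hall ↦ by
    obtain ⟨O, d₀, hO, hRay, hExh, hFut⟩ := hex
    exact h17298 X D hD 𝒟 hmax hI O d₀ hO hRay hExh hFut (hall O d₀ hO hRay hExh hFut))

/-- **G is what FULL label rigidity gives** (the expected truth, LABEL-RIGIDITY-C0-c3: the holes of two honest C⁰
decompositions of one development correspond with equal `(Mᵢ, |aᵢ|)`): sub-extremality `|a| < M` is a function of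
`(M, |a|)`, so it transfers along any such correspondence. Recorded as the cheap direction. [folklore] -/
example {n m : ℕ} (M₁ a₁ : Fin n → ℝ) (M₂ a₂ : Fin m → ℝ) (σ : Fin m → Fin n)
    (hM : ∀ j, M₂ j = M₁ (σ j)) (ha : ∀ j, |a₂ j| = |a₁ (σ j)|)
    (h₁ : ∀ i, Kerr.IsSubextremal (M₁ i) (a₁ i)) : ∀ j, Kerr.IsSubextremal (M₂ j) (a₂ j) := by
  intro j
  have := h₁ (σ j)
  unfold Kerr.IsSubextremal at this ⊢
  rw [hM j, ha j]
  exact this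

/-- Sanity: the summit's matrix implies censored ∧ un-parked pointwise, so the kick's target is consistent iff
the summit is (`censored_and_unparked_of_summitProperty`). -/
example {X : Type} [TopologicalSpace X] [ChartedSpace E3 X] [IsManifold (𝓡 3) ∞ X] [T2Space X]
    [SecondCountableTopology X] [ConnectedSpace X] {D : InitialDataSet (𝓡 3) X} (h : SummitProperty D) :
    Censored D ∧ Unparked D :=
  censored_and_unparked_of_summitProperty h


/-! ## §5 G at the MODEL POINT — the brick programme for `NoC0KerrChart` (lead c10, skeleton v5)

Stub G (`stub_labelRigidityC0`) is a research lemma in general; at the one maximal development the tree can name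
(the Minkowski development) it is EXACTLY the concrete C⁰-rigidity statement NoC0KerrChart (landed reduction
`Theorems.PhaseMixingCaptureCaptureSufficesTame.stub_labelRigidityC0_minkowski_of_noC0KerrChart`, p146217): no boosted
Kerr exterior `(Λ, c, M, a)`, `0 < M`, `|a| ≤ M`, carries a late chart into Minkowski space whose truncated C⁰
deviations tend to `0` for every radius. NoC0KerrChart is TRUE on paper (LABEL-RIGIDITY-C0-a1.md §1, with the gap in
§1.4 (iii) — "the generator through `x_n` passes through `x_n`" — repaired by lead c10: work with the INTRINSIC causal
future `J_n = J⁺(p)` of the flat metric `Ψ_n^* η` inside the compact chunk, whose boundary points are backward-lit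
until the vertex or the exit (`stub_noC0_flatGenerators`), the exit branch being excluded by the uniform
timelike-ness of `dt*` (`stub_noC0_kerrSide` (K3)); and the limit argument is run on POINTS and causal RELATIONS of the
fixed Kerr metric along an ultrafilter with the tree's local causality kit — `exists_nhds_causalCurve_dichotomy`,
`mem_chronologicalFuture_of_corner`, `exists_nhds_causalRelation_closed`, push-up, `expMap` flow, two-point `exp`
inverse — no Lipschitz limit curves). The three `stub_noC0_*` below are the self-contained BRICKS of that proof that do
not touch the limit argument (held by the lead together with the reduction boosted → rest-frame → time-shifted charts):
pure `E4` calculus over `Minkowski.bilin` (flat bricks) and explicit Kerr–Schild algebra (Kerr brick). They are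
registered so that workers can land them (`--supports`); the previously registered sub-goal
`stub_noC0KerrChartIntoMinkowski` (lead a1) is the theorem they serve and is restated below as a closed `Prop`
(`NoC0KerrChart`, no `sorry`: nothing is asserted). Conventions of the flat bricks: a FLAT CAUSAL PATH inside an open
`U ⊆ E4` from `A` to `B` is `γ : ℝ → E4`, `a < b`, `γ a = A`, `γ b = B`, differentiable at every `t ∈ [a, b]` with
`η(γ', γ') ≤ 0`, `γ'⁰ > 0` and `γ t ∈ U` (the tree's `IsFutureCausalCurveOn` for `Minkowski.spacetime`, written in
coordinates); TIMELIKE: `η(γ', γ') < 0`; the FLAT CAUSAL FUTURE of `P` inside `U` is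
`J(U, P) = {Y ∈ U | Y = P ∨ there is a flat causal path inside U from P to Y}` (spelled out in each statement). -/

section ModelPointBricks

/-- The sub-goal the bricks serve (registered 2026-08-17 by lead a1 as `stub_noC0KerrChartIntoMinkowski`; hypothesis
`h` of the landed `stub_labelRigidityC0_minkowski_of_noC0KerrChart`): NO C⁰-HONEST LATE KERR CHART INTO MINKOWSKI
SPACE. Recorded as a closed `Prop`; nothing is asserted here. [cite: arXiv210408222, §1] -/
def NoC0KerrChart : Prop :=
  ∀ (Λ : lorentzGroup) (c : E4) (M a τ₀ : ℝ), 0 < M → |a| ≤ M →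
    ∀ Ψ : (boostedKerrBackground Λ c M a).domain → Minkowski.spacetime.carrier,
      Minkowski.spacetime.IsLateChart (boostedKerrBackground Λ c M a) univ τ₀ Ψ →
      ¬ ∀ R : ℝ, Tendsto (fun τ ↦ Minkowski.spacetime.truncDeviationCk
          (boostedKerrBackground Λ c M a) Ψ 0 R τ) atTop (𝓝 0)

/-- With NoC0KerrChart, G holds at the Minkowski development (landed, p146217). -/
example (h : NoC0KerrChart) :
    ∀ (O₂ : Set Minkowski.vacuumCauchyDevelopment.carrier)
      (d₂ : FinalStateDecomposition Minkowski.vacuumCauchyDevelopment.toSpacetime O₂ 0),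
      ∀ j, Kerr.IsSubextremal (d₂.mass j) (d₂.spin j) :=
  Theorems.PhaseMixingCaptureCaptureSufficesTame.stub_labelRigidityC0_minkowski_of_noC0KerrChart h

/-- **Brick F1 `stub_noC0_flatBasics` — CAUSALITY OF MINKOWSKI SPACE RELATIVE TO AN OPEN SET (push-up and lit rays).**
For `U ⊆ E4` open and `P ∈ U`, with `J = J(U, P)` the flat causal future of `P` inside `U` (conventions in the
section docstring): (i) PUSH-UP / OPENNESS: if `A ∈ closure J`, `A, B ∈ U`, and a flat TIMELIKE path inside `U` joins
`A` to `B`, then `B ∈ interior J`; (ii) LIT RAYS ARE BOUNDARY: for a future null `d` (`η(d, d) = 0`, `d⁰ > 0`) and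
`l₀ ≥ 0` with `P + λ d ∈ U` for all `λ ∈ [0, l₀]`, every such `P + λ d` lies in `closure J` and NOT in `interior J`
(achronality of null lines of `ℝ⁴₁`: a flat timelike path from `P` ends at a point `B` with `B − P` timelike).
Elementary convex-cone geometry of `η` plus the mean value theorem in a closed convex cone; no compactness.
O'Neill 1983, Ch. 5, pp. 146–147 and Ch. 14, Cor. 14.1, Lemma 14.3 (for `ℝ⁴₁`, relative to an open set).
[cite: ONeill1983, Ch. 14, Cor. 14.1 and Lemma 14.3] -/
theorem stub_noC0_flatBasics :
    ∀ (U : Set E4), IsOpen U → ∀ P ∈ U, ∀ J : Set E4,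
      J = {Y | Y ∈ U ∧ (Y = P ∨ ∃ (γ : ℝ → E4) (a b : ℝ), a < b ∧ γ a = P ∧ γ b = Y ∧
            ∀ t ∈ Set.Icc a b, γ t ∈ U ∧ ∃ v : E4, HasDerivAt γ v t ∧ Minkowski.bilin v v ≤ 0 ∧ 0 < v 0)} →
      (∀ A B : E4, A ∈ U → B ∈ U → A ∈ closure J →
        (∃ (γ : ℝ → E4) (a b : ℝ), a < b ∧ γ a = A ∧ γ b = B ∧
            ∀ t ∈ Set.Icc a b, γ t ∈ U ∧ ∃ v : E4, HasDerivAt γ v t ∧ Minkowski.bilin v v < 0 ∧ 0 < v 0) →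
        B ∈ interior J) ∧
      (∀ d : E4, Minkowski.bilin d d = 0 → 0 < d 0 → ∀ l₀ : ℝ, 0 ≤ l₀ →
        (∀ s ∈ Set.Icc 0 l₀, P + s • d ∈ U) →
        ∀ s ∈ Set.Icc 0 l₀, P + s • d ∈ closure J ∧ P + s • d ∉ interior J) :=
  Theorems.PhaseMixingCaptureCaptureSufficesTame.stub_noC0_flatBasics

/-- **Brick F2 `stub_noC0_flatGenerators` — BOUNDARY POINTS OF A RELATIVE CAUSAL FUTURE ARE BACKWARD-LIT UNTIL THE
VERTEX OR THE EXIT** (Penrose's lemma on achronal boundaries, for `ℝ⁴₁` relative to a bounded open set), GRANTED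
brick F1 (its statement verbatim as the hypothesis). For `U ⊆ E4` open and bounded, `P ∈ U`, `J = J(U, P)`, and a
point `X ∈ U`, `X ≠ P`, of `closure J ∖ interior J`: there are a future null direction `d` and `μ > 0` such that the
backward null segment `X − λ d`, `0 ≤ λ < μ`, stays in `U ∩ (closure J ∖ interior J)`, and at `λ = μ` it either
reaches the vertex `P` or leaves `U`. Proof (lead c10, NOTES): if `X ∈ J`, a flat causal path from `P` to `X` inside
`U` that is not a null segment pushes up inside `U` (cover by balls in `U`; in a ball the flat quadratic form
`η(γ − A, γ − A)` is non-increasing along causal paths — mean value theorem in the closed cone — so each sub-arc is a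
null segment or chronological in its ball; corners give timelike chords), so `X ∈ interior J` unless `[P, X]` is a
null segment inside `U` (lit: first branch); if `X ∉ J`, inscribe/reparametrise flat causal paths `P → X_k → X` by the
time coordinate (spatially 1-Lipschitz), extract a uniform limit (Arzelà–Ascoli), which is secant-causal, touches
`∂U` (else `X ∈ J`), and whose final arc after the last contact with `∂U` is a null segment ending at `X` all of whose
points lie in `closure J ∖ interior J` (second branch). O'Neill 1983, Ch. 14, Cor. 14.27 and Prop. 10.46 (flat case);
Penrose 1972, §5; Hawking–Ellis 1973, Prop. 6.3.1. [cite: ONeill1983, Ch. 14, Cor. 14.27] [cite: HawkingEllis1973, Prop. 6.3.1] -/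
theorem stub_noC0_flatGenerators :
    (∀ (U : Set E4), IsOpen U → ∀ P ∈ U, ∀ J : Set E4,
      J = {Y | Y ∈ U ∧ (Y = P ∨ ∃ (γ : ℝ → E4) (a b : ℝ), a < b ∧ γ a = P ∧ γ b = Y ∧
            ∀ t ∈ Set.Icc a b, γ t ∈ U ∧ ∃ v : E4, HasDerivAt γ v t ∧ Minkowski.bilin v v ≤ 0 ∧ 0 < v 0)} →
      (∀ A B : E4, A ∈ U → B ∈ U → A ∈ closure J →
        (∃ (γ : ℝ → E4) (a b : ℝ), a < b ∧ γ a = A ∧ γ b = B ∧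
            ∀ t ∈ Set.Icc a b, γ t ∈ U ∧ ∃ v : E4, HasDerivAt γ v t ∧ Minkowski.bilin v v < 0 ∧ 0 < v 0) →
        B ∈ interior J) ∧
      (∀ d : E4, Minkowski.bilin d d = 0 → 0 < d 0 → ∀ l₀ : ℝ, 0 ≤ l₀ →
        (∀ s ∈ Set.Icc 0 l₀, P + s • d ∈ U) →
        ∀ s ∈ Set.Icc 0 l₀, P + s • d ∈ closure J ∧ P + s • d ∉ interior J)) →
    ∀ (U : Set E4), IsOpen U → Bornology.IsBounded U → ∀ P ∈ U, ∀ J : Set E4,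
      J = {Y | Y ∈ U ∧ (Y = P ∨ ∃ (γ : ℝ → E4) (a b : ℝ), a < b ∧ γ a = P ∧ γ b = Y ∧
            ∀ t ∈ Set.Icc a b, γ t ∈ U ∧ ∃ v : E4, HasDerivAt γ v t ∧ Minkowski.bilin v v ≤ 0 ∧ 0 < v 0)} →
      ∀ X ∈ U, X ∈ closure J → X ∉ interior J → X ≠ P →
        ∃ d : E4, Minkowski.bilin d d = 0 ∧ 0 < d 0 ∧ ∃ μ : ℝ, 0 < μ ∧
          (∀ s ∈ Set.Ico 0 μ, X - s • d ∈ U ∧ X - s • d ∈ closure J ∧ X - s • d ∉ interior J) ∧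
          (X - μ • d = P ∨ X - μ • d ∉ U) :=
  Theorems.PhaseMixingCaptureCaptureSufficesTame.stub_noC0_flatGenerators

/-- **Brick K `stub_noC0_kerrSide` — KERR–SCHILD KINEMATICS AND THE LENSING WITNESS (explicit algebra).**
(K1) the Kerr–Schild cone is narrower than the Minkowski cone of the chart, for `0 ≤ M`: `g_{M,a}(x)(v, v) ≤ 0`
forces `|v⃗|² ≤ (v⁰)²` (because `g = η + 2H ℓ ⊗ ℓ` with `H ≥ 0`); (K2) the same with room: for a bilinear form `B`
with `‖B − g_{M,a}(x)‖ ≤ 1/4`, `B(v, v) ≤ 0` forces `‖v‖ ≤ 2 |v⁰|`; (K3) hence `t*` is a uniform time function with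
bounded speed for every such perturbed cone field along differentiable curves: if `γ` is differentiable on `[s₁, s₂]`
with `B_t(γ', γ') ≤ 0`, `γ'⁰ > 0`, `‖B_t − g_{M,a}(γ t)‖ ≤ 1/4`, then `t ↦ (γ t)⁰` is strictly increasing on
`[s₁, s₂]` and `‖γ s₂ − γ s₁‖ ≤ 2 ((γ s₂)⁰ − (γ s₁)⁰)`; (W1) the static direction `∂_{t*}` is uniformly timelike
outside `r = 3M`: `g_{M,a}(x)(∂₀, ∂₀) ≤ −1/3` whenever `3M ≤ r(x)` (`2H ≤ 2M/r ≤ 2/3`); (W2) the photon orbit returns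
to its spatial point after one revolution: `orbitCurve a r₀ q (s + 2π/q) = orbitCurve a r₀ q s + ((1 − aq) 2π/q) ∂₀`;
(W3) the retrograde equatorial circular photon orbit `Kerr.orbitCurve a r₀ q` (`r₀` the photon radius,
`q = √(M/r₀³)`) is a NULL GEODESIC of the Levi-Civita connection of `Kerr.smoothMetric M a r₊` lying in the exterior
— the tree's `Kerr.exists_trappedNullGeodesic` with the curve exposed (same proof: `OpensChart.isGeodesic_of_hasDerivAt`
with `Kerr.christoffel_orbitVel`, `Kerr.bilin_orbitVel_self`). Kerr–Schild 1965; Visser arXiv:0706.0622 (32)–(35);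
Bardeen–Press–Teukolsky 1972 (2.18); Sbierski 2015 §7A. [cite: arXiv07060622, (32)–(35)] [cite: Sbierski2015, §7A] -/
theorem stub_noC0_kerrSide :
    (∀ (M a : ℝ) (x v : E4), 0 ≤ M → Kerr.bilin M a x v v ≤ 0 → E4.spatialNorm v ^ 2 ≤ (v 0) ^ 2) ∧
    (∀ (M a : ℝ) (x v : E4) (B : E4 →L[ℝ] E4 →L[ℝ] ℝ), 0 ≤ M → ‖B - Kerr.bilin M a x‖ ≤ 1 / 4 →
      B v v ≤ 0 → ‖v‖ ≤ 2 * |v 0|) ∧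
    (∀ (M a : ℝ) (B : ℝ → E4 →L[ℝ] E4 →L[ℝ] ℝ) (γ : ℝ → E4) (s₁ s₂ : ℝ), 0 ≤ M → s₁ ≤ s₂ →
      (∀ t ∈ Set.Icc s₁ s₂, ‖B t - Kerr.bilin M a (γ t)‖ ≤ 1 / 4 ∧
        ∃ v : E4, HasDerivAt γ v t ∧ B t v v ≤ 0 ∧ 0 < v 0) →
      StrictMonoOn (fun t ↦ γ t 0) (Set.Icc s₁ s₂) ∧ ‖γ s₂ - γ s₁‖ ≤ 2 * (γ s₂ 0 - γ s₁ 0)) ∧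
    (∀ (M a : ℝ) (x : E4), 0 ≤ M → 3 * M ≤ Kerr.radius a x →
      Kerr.bilin M a x (E4.basisVector 0) (E4.basisVector 0) ≤ -(1 / 3)) ∧
    (∀ (a r₀ q s : ℝ), q ≠ 0 →
      Kerr.orbitCurve a r₀ q (s + 2 * Real.pi / q) =
        Kerr.orbitCurve a r₀ q s + ((1 - a * q) * (2 * Real.pi / q)) • E4.basisVector 0) ∧
    (∀ [Kerr.Facts] [Kerr.SliceFacts] (M a r₀ : ℝ), 0 < M → 0 ≤ a → a ≤ M → 3 * M ≤ r₀ →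
      r₀ * (r₀ - 3 * M) ^ 2 = 4 * a ^ 2 * M →
      ∀ h : ∀ s, Kerr.orbitCurve a r₀ √(M / r₀ ^ 3) s ∈ Kerr.exterior M a,
        Kerr.rPlus M a < r₀ ∧
        IsGeodesic (Kerr.smoothMetric M a (Kerr.rPlus M a)).leviCivita
          (fun s ↦ (⟨Kerr.orbitCurve a r₀ √(M / r₀ ^ 3) s, h s⟩ : Kerr.exterior M a)) ∧
        (∀ s, (Kerr.smoothMetric M a (Kerr.rPlus M a)).IsNull
          (velocity 𝓘(ℝ, E4) (fun s ↦ (⟨Kerr.orbitCurve a r₀ √(M / r₀ ^ 3) s, h s⟩ : Kerr.exterior M a)) s)) ∧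
        (∀ s, velocity 𝓘(ℝ, E4) (fun s ↦ (⟨Kerr.orbitCurve a r₀ √(M / r₀ ^ 3) s, h s⟩ : Kerr.exterior M a)) s =
          Kerr.orbitVel a √(M / r₀ ^ 3) (Kerr.orbitCurve a r₀ √(M / r₀ ^ 3) s))) :=
  Theorems.PhaseMixingCaptureCaptureSufficesTame.stub_noC0_kerrSide

end ModelPointBricks

end Summit.FinalStateConjecture.FinalStateConjecture.Cruxes.CaptureSufficesTame.OnlyTheThirdLawIsGeneric

end
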